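import Mathlib
import HarnessLib
import Literature.Analysis.FluidPDE.BeltramiFlows
import Literature.Analysis.Calculus.SimplifiedNewton
import Summits.NavierStokesRegularity.FluidComputer.ABCSkeletonPersistence

/-!
# Persistence of the ABC 1:1:1 stagnation points — LOCAL FORM (hypotheses on a ball around the point only)
# (instab lane, door O-acc = O7 / obstruction P3; companion of `ABCSkeletonPersistence`; cell `ns-blowup`,
# seat `ns-blowup-instab2`)

HONEST FRAMING (human ruling D-0035): nothing here is a claim about Navier–Stokes. WHAT THIS IS NOT: not dynamics —
calculus on the tree's ABC field `U = Literature.Analysis.FluidPDE.ABC.abc 1 1 1` on `E = EuclideanSpace ℝ (Fin 3)`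
and the tree's simplified-Newton theorem `Literature.Analysis.Calculus.exists_zero_near_of_simplifiedNewton`
(Magnus 2022, Prop. 6.7). `G` is a free field; in the cell's use it is the instantaneous perturbation velocity
`u(·,t)/a(t) − U` of a P-TOWER run and the theorem says where the zeros of `U + G` must lie.

## Why a second file
`ABCSkeletonPersistence.exists_unique_zero_near_of_abc_eq_zero` (§4 there) asks that `G` be differentiable
EVERYWHERE with a GLOBALLY `M`-Lipschitz derivative. For a velocity snapshot the only rigorous global Lipschitz
constant at hand is the spectral sum `Σ_k |k|²|Ĝ_k|`, which ignores the phase cancellation at the point and is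
10–100× too large on the cell's data (instrument `skeleton_persist.py` v1.1: VERIFIED 0 of 34 consistent
point-instants). But Magnus's theorem is LOCAL: it needs differentiability of `f` and the RADIAL bound
`‖f'(x) − f'(a)‖ ≤ M‖x − a‖` only on the closed Newton ball `B̄(a, 2‖A⁻¹f(a)‖)`. This file records the persistence
statement in that form.

## What is proved (Mathlib + `BeltramiFlows` + `SimplifiedNewton` + `ABCSkeletonPersistence`; no definitions)
* `norm_fderiv_add_sub_le_of_radial`: radial glue `‖(DU(x)+G'(x)) − (DU(x₀)+G'(x₀))‖ ≤ (2+M)‖x − x₀‖` from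
  `‖G'(x) − G'(x₀)‖ ≤ M‖x − x₀‖` (host part: `ABCSkeletonPersistence.norm_fderiv_sub_fderiv_le`);
* **`exists_unique_zero_near_of_abc_eq_zero_local`**: `U x₀ = 0`, `δ₁ < √2/2`, `0 ≤ M`,
  `ρ ≥ 2‖G(x₀)‖/(√2/2 − δ₁)`; `G` differentiable with derivative `G'` on `B̄(x₀, ρ)`, `‖G'(x₀)‖ ≤ δ₁`,
  `‖G'(x) − G'(x₀)‖ ≤ M‖x − x₀‖` on `B̄(x₀, ρ)`, `4(2+M)‖G(x₀)‖ ≤ (√2/2 − δ₁)²` ⟹ a radius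
  `r ≤ 2‖G(x₀)‖/(√2/2 − δ₁)` with EXACTLY ONE zero of `U + G` in `B̄(x₀, r)`, non-degenerate;
  (the global §4 statement is the special case `ρ := 2‖G(x₀)‖/(√2/2 − δ₁)` with the hypotheses restricted from
  everywhere to the ball — not restated here);
* `radial_lipschitz_of_norm_fderiv_le`: mean-value form — `‖DG'‖ ≤ M` on the ball gives the radial bound, so a bound
  on `sup_{B̄(x₀,ρ)} ‖∇²G‖` is an admissible `M`.
So every hypothesis is a statement about `G` on `B̄(x₀, ρ)`: value and gradient AT the point (exact spectral
evaluation) and ONE number `M` bounding the Taylor series of `∇G` at `x₀` over the ball (instrument v1.2).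
LABEL: MODEL-door kinematics. WHAT THIS IS NOT: not NS; nothing is evolved; `G` is a free field.
-/

namespace Summit.NavierStokesRegularity.FluidComputer.ABCSkeletonPersistenceLocal

open Real Metric Set Literature.Analysis.FluidPDE ABCSkeletonPersistence

/-- Radial glue: if `‖G'(x) − G'(x₀)‖ ≤ M‖x − x₀‖` then the perturbed Jacobian satisfies
`‖(DU(x) + G'(x)) − (DU(x₀) + G'(x₀))‖ ≤ (2 + M)‖x − x₀‖` (host part from `norm_fderiv_sub_fderiv_le`). -/
theorem norm_fderiv_add_sub_le_of_radial
    {G' : EuclideanSpace ℝ (Fin 3) → EuclideanSpace ℝ (Fin 3) →L[ℝ] EuclideanSpace ℝ (Fin 3)}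
    {M : ℝ} {x x₀ : EuclideanSpace ℝ (Fin 3)} (hlip : ‖G' x - G' x₀‖ ≤ M * ‖x - x₀‖) :
    ‖(fderiv ℝ (ABC.abc 1 1 1) x + G' x) - (fderiv ℝ (ABC.abc 1 1 1) x₀ + G' x₀)‖ ≤ (2 + M) * ‖x - x₀‖ := by
  calc ‖(fderiv ℝ (ABC.abc 1 1 1) x + G' x) - (fderiv ℝ (ABC.abc 1 1 1) x₀ + G' x₀)‖
      = ‖(fderiv ℝ (ABC.abc 1 1 1) x - fderiv ℝ (ABC.abc 1 1 1) x₀) + (G' x - G' x₀)‖ := by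
        congr 1; abel
    _ ≤ ‖fderiv ℝ (ABC.abc 1 1 1) x - fderiv ℝ (ABC.abc 1 1 1) x₀‖ + ‖G' x - G' x₀‖ := norm_add_le _ _
    _ ≤ 2 * ‖x - x₀‖ + M * ‖x - x₀‖ := add_le_add (norm_fderiv_sub_fderiv_le x x₀) hlip
    _ = (2 + M) * ‖x - x₀‖ := by ring

/-- **PERSISTENCE OF A STAGNATION POINT — LOCAL FORM.** Let `U x₀ = 0` (any of the eight skeleton zeros), let
`δ₁ < √2/2`, `0 ≤ M`, and let `ρ ≥ 2‖G(x₀)‖/(√2/2 − δ₁)`. Suppose the perturbation `G` is differentiable with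
derivative `G'` at every point of the closed ball `B̄(x₀, ρ)`, that `‖G'(x₀)‖ ≤ δ₁`, that the RADIAL Lipschitz bound
`‖G'(x) − G'(x₀)‖ ≤ M‖x − x₀‖` holds for `x ∈ B̄(x₀, ρ)`, and that `4(2 + M)‖G(x₀)‖ ≤ (√2/2 − δ₁)²`. Then there is a
radius `r ≤ 2‖G(x₀)‖/(√2/2 − δ₁)` (so `r ≤ ρ`) such that `U + G` has EXACTLY ONE zero `z` in `B̄(x₀, r)`, and
`D(U+G)(z)` is invertible. Every hypothesis is a statement about `G` on `B̄(x₀, ρ)` — the form a velocity snapshot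
can certify point by point (value and gradient at `x₀` exactly; `M` from the Taylor series of `∇G` at `x₀` with a
remainder bound). Proof: Magnus 2022 Prop. 6.7 (`exists_zero_near_of_simplifiedNewton`) with `A = DU(x₀) + G'(x₀)`,
`‖A⁻¹‖ ≤ 1/(√2/2 − δ₁)` (`exists_equiv_fderiv_add`), Lipschitz constant `2 + M` on the Newton ball
`B̄(x₀, 2‖A⁻¹G(x₀)‖) ⊆ B̄(x₀, ρ)`. -/
theorem exists_unique_zero_near_of_abc_eq_zero_local {x₀ : EuclideanSpace ℝ (Fin 3)}
    (h0 : ABC.abc 1 1 1 x₀ = 0)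
    {G : EuclideanSpace ℝ (Fin 3) → EuclideanSpace ℝ (Fin 3)}
    {G' : EuclideanSpace ℝ (Fin 3) → EuclideanSpace ℝ (Fin 3) →L[ℝ] EuclideanSpace ℝ (Fin 3)}
    {M δ₁ ρ : ℝ} (hM : 0 ≤ M) (hδ : δ₁ < Real.sqrt 2 / 2)
    (hρ : 2 * ‖G x₀‖ / (Real.sqrt 2 / 2 - δ₁) ≤ ρ)
    (hG : ∀ x ∈ closedBall x₀ ρ, HasFDerivAt G (G' x) x)
    (hlipG : ∀ x ∈ closedBall x₀ ρ, ‖G' x - G' x₀‖ ≤ M * ‖x - x₀‖)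
    (hG' : ‖G' x₀‖ ≤ δ₁) (hsmall : 4 * (2 + M) * ‖G x₀‖ ≤ (Real.sqrt 2 / 2 - δ₁) ^ 2) :
    ∃ r : ℝ, 0 ≤ r ∧ r ≤ 2 * ‖G x₀‖ / (Real.sqrt 2 / 2 - δ₁) ∧
      ∃ z ∈ closedBall x₀ r, ABC.abc 1 1 1 z + G z = 0 ∧ (fderiv ℝ (ABC.abc 1 1 1) z + G' z).IsInvertible ∧
        ∀ y ∈ closedBall x₀ r, ABC.abc 1 1 1 y + G y = 0 → y = z := by
  set c : ℝ := Real.sqrt 2 / 2 - δ₁ with hc_def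
  have hc : 0 < c := by rw [hc_def]; linarith
  -- the frozen Jacobian `A = DU(x₀) + G'(x₀)` as an isomorphism with `‖A⁻¹‖ ≤ 1/c`
  obtain ⟨e, he, hβ⟩ := exists_equiv_fderiv_add h0 (G' x₀) hG' hδ
  set f : EuclideanSpace ℝ (Fin 3) → EuclideanSpace ℝ (Fin 3) := fun x => ABC.abc 1 1 1 x + G x with hf_def
  set f' : EuclideanSpace ℝ (Fin 3) → EuclideanSpace ℝ (Fin 3) →L[ℝ] EuclideanSpace ℝ (Fin 3) :=
    fun x => fderiv ℝ (ABC.abc 1 1 1) x + G' x with hf'_def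
  have ha : f' x₀ = (e : EuclideanSpace ℝ (Fin 3) →L[ℝ] EuclideanSpace ℝ (Fin 3)) := by rw [he]
  have hfa : f x₀ = G x₀ := by simp [hf_def, h0]
  -- `η = ‖A⁻¹ f(x₀)‖ ≤ ‖G x₀‖ / c`, so the Newton ball `B̄(x₀, 2η)` lies inside `B̄(x₀, ρ)`
  set η : ℝ := ‖e.symm (f x₀)‖ with hη_def
  have hη : η ≤ ‖G x₀‖ / c := by
    rw [hη_def, hfa]
    calc ‖e.symm (G x₀)‖ = ‖(e.symm : EuclideanSpace ℝ (Fin 3) →L[ℝ] EuclideanSpace ℝ (Fin 3)) (G x₀)‖ := rfl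
      _ ≤ ‖(e.symm : EuclideanSpace ℝ (Fin 3) →L[ℝ] EuclideanSpace ℝ (Fin 3))‖ * ‖G x₀‖ :=
          ContinuousLinearMap.le_opNorm _ _
      _ ≤ 1 / c * ‖G x₀‖ := mul_le_mul_of_nonneg_right hβ (norm_nonneg _)
      _ = ‖G x₀‖ / c := by ring
  have hη0 : 0 ≤ η := norm_nonneg _
  have h2η : 2 * η ≤ 2 * ‖G x₀‖ / c := by
    rw [mul_div_assoc]; exact mul_le_mul_of_nonneg_left hη (by norm_num)
  have hsub : closedBall x₀ (2 * η) ⊆ closedBall x₀ ρ := closedBall_subset_closedBall (h2η.trans hρ)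
  have hf : ∀ x ∈ closedBall x₀ (2 * η), HasFDerivAt f (f' x) x := fun x hx =>
    ((ABC.differentiable_abc 1 1 1 x).hasFDerivAt).add (hG x (hsub hx))
  have hlip : ∀ x ∈ closedBall x₀ (2 * η), ‖f' x - f' x₀‖ ≤ (2 + M) * ‖x - x₀‖ := fun x hx =>
    norm_fderiv_add_sub_le_of_radial (hlipG x (hsub hx))
  -- Magnus's smallness condition `4·(2+M)·‖A⁻¹‖·η ≤ 1`
  have hβ0 : 0 ≤ ‖(e.symm : EuclideanSpace ℝ (Fin 3) →L[ℝ] EuclideanSpace ℝ (Fin 3))‖ := norm_nonneg _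
  have hcond : 4 * (2 + M) * ‖(e.symm : EuclideanSpace ℝ (Fin 3) →L[ℝ] EuclideanSpace ℝ (Fin 3))‖ * η ≤ 1 := by
    have h1 : 4 * (2 + M) * ‖(e.symm : EuclideanSpace ℝ (Fin 3) →L[ℝ] EuclideanSpace ℝ (Fin 3))‖ * η ≤
        4 * (2 + M) * (1 / c) * (‖G x₀‖ / c) := by
      have h2M : 0 ≤ 4 * (2 + M) := by positivity
      calc 4 * (2 + M) * ‖(e.symm : EuclideanSpace ℝ (Fin 3) →L[ℝ] EuclideanSpace ℝ (Fin 3))‖ * η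
          ≤ 4 * (2 + M) * (1 / c) * η := by gcongr
        _ ≤ 4 * (2 + M) * (1 / c) * (‖G x₀‖ / c) := by gcongr
    have h2 : 4 * (2 + M) * (1 / c) * (‖G x₀‖ / c) = (4 * (2 + M) * ‖G x₀‖) / c ^ 2 := by
      field_simp
    have h3 : (4 * (2 + M) * ‖G x₀‖) / c ^ 2 ≤ 1 := by
      rw [div_le_one (by positivity)]; exact hsmall
    exact h1.trans (h2.le.trans h3)
  obtain ⟨z, hz, hfz, hinv, huniq, -⟩ :=
    Literature.Analysis.Calculus.exists_zero_near_of_simplifiedNewton (f := f) (f' := f') (a := x₀) (A := e)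
      (M := 2 + M) (by positivity) hf ha hlip hcond
  exact ⟨2 * η, by positivity, h2η, z, hz, hfz, hinv, huniq⟩

/-- **SECOND-DERIVATIVE FORM of the radial bound** (mean-value inequality on the convex ball): if `G'` is itself
differentiable on `B̄(x₀, ρ)` with `‖DG'(x)‖ ≤ M` there, then `‖G'(x) − G'(x₀)‖ ≤ M‖x − x₀‖` on the ball — so a
bound on `sup_{B̄(x₀,ρ)} ‖∇²G‖` is an admissible `M` for `exists_unique_zero_near_of_abc_eq_zero_local`. -/
theorem radial_lipschitz_of_norm_fderiv_le
    {G' : EuclideanSpace ℝ (Fin 3) → EuclideanSpace ℝ (Fin 3) →L[ℝ] EuclideanSpace ℝ (Fin 3)}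
    {G'' : EuclideanSpace ℝ (Fin 3) →
      EuclideanSpace ℝ (Fin 3) →L[ℝ] (EuclideanSpace ℝ (Fin 3) →L[ℝ] EuclideanSpace ℝ (Fin 3))}
    {M ρ : ℝ} {x₀ : EuclideanSpace ℝ (Fin 3)}
    (hG'' : ∀ x ∈ closedBall x₀ ρ, HasFDerivAt G' (G'' x) x) (hbound : ∀ x ∈ closedBall x₀ ρ, ‖G'' x‖ ≤ M) :
    ∀ x ∈ closedBall x₀ ρ, ‖G' x - G' x₀‖ ≤ M * ‖x - x₀‖ := by
  intro x hx
  rcases le_or_gt 0 ρ with hρ | hρ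
  · have hx₀ : x₀ ∈ closedBall x₀ ρ := mem_closedBall_self hρ
    exact (convex_closedBall x₀ ρ).norm_image_sub_le_of_norm_hasFDerivWithin_le
      (fun y hy => (hG'' y hy).hasFDerivWithinAt) hbound hx₀ hx
  · exact absurd hx (by rw [closedBall_eq_empty.mpr hρ]; exact Set.notMem_empty x)

/-- **PERSISTENCE FROM A HESSIAN BOUND** — the two previous statements chained: `U x₀ = 0`, `G` of class `C²` on
`B̄(x₀, ρ)` in the sense `HasFDerivAt G (G' x) x` and `HasFDerivAt G' (G'' x) x` there, `‖G''(x)‖ ≤ M` on the ball,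
`‖G'(x₀)‖ ≤ δ₁ < √2/2`, `ρ ≥ 2‖G(x₀)‖/(√2/2 − δ₁)` and `4(2 + M)‖G(x₀)‖ ≤ (√2/2 − δ₁)²` ⟹ exactly one zero of
`U + G` within `2‖G(x₀)‖/(√2/2 − δ₁)` of `x₀`, non-degenerate. -/
theorem exists_unique_zero_near_of_abc_eq_zero_of_hessian {x₀ : EuclideanSpace ℝ (Fin 3)}
    (h0 : ABC.abc 1 1 1 x₀ = 0)
    {G : EuclideanSpace ℝ (Fin 3) → EuclideanSpace ℝ (Fin 3)}
    {G' : EuclideanSpace ℝ (Fin 3) → EuclideanSpace ℝ (Fin 3) →L[ℝ] EuclideanSpace ℝ (Fin 3)}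
    {G'' : EuclideanSpace ℝ (Fin 3) →
      EuclideanSpace ℝ (Fin 3) →L[ℝ] (EuclideanSpace ℝ (Fin 3) →L[ℝ] EuclideanSpace ℝ (Fin 3))}
    {M δ₁ ρ : ℝ} (hM : 0 ≤ M) (hδ : δ₁ < Real.sqrt 2 / 2)
    (hρ : 2 * ‖G x₀‖ / (Real.sqrt 2 / 2 - δ₁) ≤ ρ)
    (hG : ∀ x ∈ closedBall x₀ ρ, HasFDerivAt G (G' x) x)
    (hG'' : ∀ x ∈ closedBall x₀ ρ, HasFDerivAt G' (G'' x) x) (hbound : ∀ x ∈ closedBall x₀ ρ, ‖G'' x‖ ≤ M)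
    (hG' : ‖G' x₀‖ ≤ δ₁) (hsmall : 4 * (2 + M) * ‖G x₀‖ ≤ (Real.sqrt 2 / 2 - δ₁) ^ 2) :
    ∃ r : ℝ, 0 ≤ r ∧ r ≤ 2 * ‖G x₀‖ / (Real.sqrt 2 / 2 - δ₁) ∧
      ∃ z ∈ closedBall x₀ r, ABC.abc 1 1 1 z + G z = 0 ∧ (fderiv ℝ (ABC.abc 1 1 1) z + G' z).IsInvertible ∧
        ∀ y ∈ closedBall x₀ r, ABC.abc 1 1 1 y + G y = 0 → y = z :=
  exists_unique_zero_near_of_abc_eq_zero_local h0 hM hδ hρ hG (radial_lipschitz_of_norm_fderiv_le hG'' hbound)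
    hG' hsmall

/-! ## §6 (appended, instab2 g7) The host Jacobian is `1`-Lipschitz, not `2`: sharpened smallness `4(1 + M)‖G(x₀)‖ ≤ c²`

`ABCSkeletonPersistence.norm_fderiv_sub_fderiv_le` bounds each Jacobian ENTRY by `‖x − y‖` and gets `‖DU(x) − DU(y)‖ ≤ 2‖x − y‖`.
But column `j` of `DU(x)` is the unit vector `(cos x_j, −sin x_j)` placed in the two rows `≠ j`, so column `j` of
`DU(x) − DU(y)` has squared length `(sin x_j − sin y_j)² + (cos x_j − cos y_j)² = 2 − 2cos(x_j − y_j) ≤ (x_j − y_j)²`, and the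
Frobenius norm of the difference is at most `‖x − y‖`: **`‖DU(x) − DU(y)‖ ≤ ‖x − y‖`** (sharp as `y → x` along a coordinate
axis). The persistence theorems then hold with the host constant `1` in place of `2`, i.e. with the weaker smallness
hypothesis `4(1 + M)‖G(x₀)‖ ≤ (√2/2 − δ₁)²` — the budget `M_max = c²/(4|G(p)|) − 1` of instrument v1.2. -/

/-- Components of a vector of `E` square-sum to the norm squared (local copy of the private helper). -/
private theorem norm_sq_eq_three' (w : EuclideanSpace ℝ (Fin 3)) : ‖w‖ ^ 2 = w 0 ^ 2 + w 1 ^ 2 + w 2 ^ 2 := by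
  rw [EuclideanSpace.norm_sq_eq, Fin.sum_univ_three]
  simp [sq_abs]

/-- Two-term Cauchy–Schwarz (local copy of the private helper). -/
private theorem sq_add_le_mul' (a b p q : ℝ) : (a * p + b * q) ^ 2 ≤ (a ^ 2 + b ^ 2) * (p ^ 2 + q ^ 2) := by
  nlinarith [sq_nonneg (a * q - b * p)]

/-- The chord of the unit circle is shorter than the arc: `(sin a − sin b)² + (cos a − cos b)² ≤ (a − b)²`
(`= 2 − 2cos(a − b)` and `1 − t²/2 ≤ cos t`). -/
theorem sin_sub_sq_add_cos_sub_sq_le (a b : ℝ) :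
    (Real.sin a - Real.sin b) ^ 2 + (Real.cos a - Real.cos b) ^ 2 ≤ (a - b) ^ 2 := by
  have h1 : (Real.sin a - Real.sin b) ^ 2 + (Real.cos a - Real.cos b) ^ 2 = 2 - 2 * Real.cos (a - b) := by
    rw [Real.cos_sub]; nlinarith [Real.sin_sq_add_cos_sq a, Real.sin_sq_add_cos_sq b]
  rw [h1]
  linarith [Real.one_sub_sq_div_two_le_cos (x := a - b)]

/-- Coordinate form: `(sin x_k − sin y_k)² + (cos x_k − cos y_k)² ≤ (x_k − y_k)²` for points of `E`. -/
theorem sin_cos_coord_sub_sq_le (x y : EuclideanSpace ℝ (Fin 3)) (k : Fin 3) :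
    (Real.sin (x k) - Real.sin (y k)) ^ 2 + (Real.cos (x k) - Real.cos (y k)) ^ 2 ≤ (x k - y k) ^ 2 :=
  sin_sub_sq_add_cos_sub_sq_le _ _

/-- **THE HOST JACOBIAN IS 1-LIPSCHITZ**: `‖DU(x) − DU(y)‖ ≤ ‖x − y‖` for all `x, y ∈ E` (operator norm; the
Frobenius norm of the difference is `(Σ_j 2 − 2cos(x_j − y_j))^{1/2} ≤ ‖x − y‖`). Sharpens
`ABCSkeletonPersistence.norm_fderiv_sub_fderiv_le` (constant `2`) by a factor of two. -/
theorem norm_fderiv_sub_fderiv_le_dist (x y : EuclideanSpace ℝ (Fin 3)) :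
    ‖fderiv ℝ (ABC.abc 1 1 1) x - fderiv ℝ (ABC.abc 1 1 1) y‖ ≤ ‖x - y‖ := by
  refine ContinuousLinearMap.opNorm_le_bound _ (norm_nonneg _) fun v => ?_
  obtain ⟨ax0, ax1, ax2⟩ := fderiv_abc_apply x v
  obtain ⟨ay0, ay1, ay2⟩ := fderiv_abc_apply y v
  have hw : ‖(fderiv ℝ (ABC.abc 1 1 1) x - fderiv ℝ (ABC.abc 1 1 1) y) v‖ ^ 2 =
      (-(v 1) * (Real.sin (x 1) - Real.sin (y 1)) + v 2 * (Real.cos (x 2) - Real.cos (y 2))) ^ 2 +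
      (v 0 * (Real.cos (x 0) - Real.cos (y 0)) + -(v 2) * (Real.sin (x 2) - Real.sin (y 2))) ^ 2 +
      (-(v 0) * (Real.sin (x 0) - Real.sin (y 0)) + v 1 * (Real.cos (x 1) - Real.cos (y 1))) ^ 2 := by
    rw [norm_sq_eq_three',
      show (fderiv ℝ (ABC.abc 1 1 1) x - fderiv ℝ (ABC.abc 1 1 1) y) v =
        fderiv ℝ (ABC.abc 1 1 1) x v - fderiv ℝ (ABC.abc 1 1 1) y v from rfl]
    simp only [PiLp.sub_apply, ax0, ax1, ax2, ay0, ay1, ay2]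
    ring
  -- abbreviations: `sₖ = sin xₖ − sin yₖ`, `cₖ = cos xₖ − cos yₖ`, `V = |v|²`
  set s0 : ℝ := Real.sin (x 0) - Real.sin (y 0) with hs0
  set s1 : ℝ := Real.sin (x 1) - Real.sin (y 1) with hs1
  set s2 : ℝ := Real.sin (x 2) - Real.sin (y 2) with hs2
  set c0 : ℝ := Real.cos (x 0) - Real.cos (y 0) with hc0
  set c1 : ℝ := Real.cos (x 1) - Real.cos (y 1) with hc1
  set c2 : ℝ := Real.cos (x 2) - Real.cos (y 2) with hc2
  -- per-coordinate chord bounds `s_k² + c_k² ≤ d_k²`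
  have j0 : s0 ^ 2 + c0 ^ 2 ≤ (x 0 - y 0) ^ 2 := sin_cos_coord_sub_sq_le x y 0
  have j1 : s1 ^ 2 + c1 ^ 2 ≤ (x 1 - y 1) ^ 2 := sin_cos_coord_sub_sq_le x y 1
  have j2 : s2 ^ 2 + c2 ^ 2 ≤ (x 2 - y 2) ^ 2 := sin_cos_coord_sub_sq_le x y 2
  have hV : 0 ≤ v 0 ^ 2 + v 1 ^ 2 + v 2 ^ 2 := by positivity
  -- row-wise two-term Cauchy–Schwarz, then enlarge the `v`-factor to `|v|²`
  have e12 : v 1 ^ 2 + v 2 ^ 2 ≤ v 0 ^ 2 + v 1 ^ 2 + v 2 ^ 2 := by linarith [sq_nonneg (v 0)]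
  have e02 : v 0 ^ 2 + v 2 ^ 2 ≤ v 0 ^ 2 + v 1 ^ 2 + v 2 ^ 2 := by linarith [sq_nonneg (v 1)]
  have e01 : v 0 ^ 2 + v 1 ^ 2 ≤ v 0 ^ 2 + v 1 ^ 2 + v 2 ^ 2 := by linarith [sq_nonneg (v 2)]
  have n12 : 0 ≤ s1 ^ 2 + c2 ^ 2 := by positivity
  have n02 : 0 ≤ c0 ^ 2 + s2 ^ 2 := by positivity
  have n01 : 0 ≤ s0 ^ 2 + c1 ^ 2 := by positivity
  have f0 : (-(v 1) * s1 + v 2 * c2) ^ 2 ≤ (v 0 ^ 2 + v 1 ^ 2 + v 2 ^ 2) * (s1 ^ 2 + c2 ^ 2) := by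
    have h : (-(v 1) * s1 + v 2 * c2) ^ 2 ≤ ((-(v 1)) ^ 2 + v 2 ^ 2) * (s1 ^ 2 + c2 ^ 2) :=
      sq_add_le_mul' (-(v 1)) (v 2) s1 c2
    rw [neg_sq] at h
    exact h.trans (mul_le_mul_of_nonneg_right e12 n12)
  have f1 : (v 0 * c0 + -(v 2) * s2) ^ 2 ≤ (v 0 ^ 2 + v 1 ^ 2 + v 2 ^ 2) * (c0 ^ 2 + s2 ^ 2) := by
    have h : (v 0 * c0 + -(v 2) * s2) ^ 2 ≤ (v 0 ^ 2 + (-(v 2)) ^ 2) * (c0 ^ 2 + s2 ^ 2) :=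
      sq_add_le_mul' (v 0) (-(v 2)) c0 s2
    rw [neg_sq] at h
    exact h.trans (mul_le_mul_of_nonneg_right e02 n02)
  have f2 : (-(v 0) * s0 + v 1 * c1) ^ 2 ≤ (v 0 ^ 2 + v 1 ^ 2 + v 2 ^ 2) * (s0 ^ 2 + c1 ^ 2) := by
    have h : (-(v 0) * s0 + v 1 * c1) ^ 2 ≤ ((-(v 0)) ^ 2 + v 1 ^ 2) * (s0 ^ 2 + c1 ^ 2) :=
      sq_add_le_mul' (-(v 0)) (v 1) s0 c1
    rw [neg_sq] at h
    exact h.trans (mul_le_mul_of_nonneg_right e01 n01)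
  have hsum : (v 0 ^ 2 + v 1 ^ 2 + v 2 ^ 2) * (s1 ^ 2 + c2 ^ 2) + (v 0 ^ 2 + v 1 ^ 2 + v 2 ^ 2) * (c0 ^ 2 + s2 ^ 2) +
      (v 0 ^ 2 + v 1 ^ 2 + v 2 ^ 2) * (s0 ^ 2 + c1 ^ 2) ≤
      (v 0 ^ 2 + v 1 ^ 2 + v 2 ^ 2) * ((x 0 - y 0) ^ 2 + (x 1 - y 1) ^ 2 + (x 2 - y 2) ^ 2) := by
    have h : (v 0 ^ 2 + v 1 ^ 2 + v 2 ^ 2) * (s1 ^ 2 + c2 ^ 2) + (v 0 ^ 2 + v 1 ^ 2 + v 2 ^ 2) * (c0 ^ 2 + s2 ^ 2) +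
        (v 0 ^ 2 + v 1 ^ 2 + v 2 ^ 2) * (s0 ^ 2 + c1 ^ 2) =
        (v 0 ^ 2 + v 1 ^ 2 + v 2 ^ 2) * ((s0 ^ 2 + c0 ^ 2) + (s1 ^ 2 + c1 ^ 2) + (s2 ^ 2 + c2 ^ 2)) := by ring
    rw [h]
    exact mul_le_mul_of_nonneg_left (by linarith) hV
  have hxy : ‖x - y‖ ^ 2 = (x 0 - y 0) ^ 2 + (x 1 - y 1) ^ 2 + (x 2 - y 2) ^ 2 := by
    rw [norm_sq_eq_three']; simp only [PiLp.sub_apply]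
  have hv : (‖x - y‖ * ‖v‖) ^ 2 = (v 0 ^ 2 + v 1 ^ 2 + v 2 ^ 2) * ‖x - y‖ ^ 2 := by
    rw [mul_pow, norm_sq_eq_three' v]; ring
  have key : ‖(fderiv ℝ (ABC.abc 1 1 1) x - fderiv ℝ (ABC.abc 1 1 1) y) v‖ ^ 2 ≤ (‖x - y‖ * ‖v‖) ^ 2 := by
    rw [hw, hv, hxy]
    linarith [f0, f1, f2, hsum]
  exact (pow_le_pow_iff_left₀ (norm_nonneg _) (by positivity) two_ne_zero).1 key

/-- Radial glue with the sharp host constant: `‖(DU(x) + G'(x)) − (DU(x₀) + G'(x₀))‖ ≤ (1 + M)‖x − x₀‖`. -/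
theorem norm_fderiv_add_sub_le_of_radial_one
    {G' : EuclideanSpace ℝ (Fin 3) → EuclideanSpace ℝ (Fin 3) →L[ℝ] EuclideanSpace ℝ (Fin 3)}
    {M : ℝ} {x x₀ : EuclideanSpace ℝ (Fin 3)} (hlip : ‖G' x - G' x₀‖ ≤ M * ‖x - x₀‖) :
    ‖(fderiv ℝ (ABC.abc 1 1 1) x + G' x) - (fderiv ℝ (ABC.abc 1 1 1) x₀ + G' x₀)‖ ≤ (1 + M) * ‖x - x₀‖ := by
  calc ‖(fderiv ℝ (ABC.abc 1 1 1) x + G' x) - (fderiv ℝ (ABC.abc 1 1 1) x₀ + G' x₀)‖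
      = ‖(fderiv ℝ (ABC.abc 1 1 1) x - fderiv ℝ (ABC.abc 1 1 1) x₀) + (G' x - G' x₀)‖ := by
        congr 1; abel
    _ ≤ ‖fderiv ℝ (ABC.abc 1 1 1) x - fderiv ℝ (ABC.abc 1 1 1) x₀‖ + ‖G' x - G' x₀‖ := norm_add_le _ _
    _ ≤ ‖x - x₀‖ + M * ‖x - x₀‖ := add_le_add (norm_fderiv_sub_fderiv_le_dist x x₀) hlip
    _ = (1 + M) * ‖x - x₀‖ := by ring

/-- **PERSISTENCE, LOCAL FORM, SHARP HOST CONSTANT.** As `exists_unique_zero_near_of_abc_eq_zero_local`, with the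
smallness hypothesis weakened to `4(1 + M)‖G(x₀)‖ ≤ (√2/2 − δ₁)²` (host Jacobian `1`-Lipschitz): `U x₀ = 0`,
`δ₁ < √2/2`, `0 ≤ M`, `ρ ≥ 2‖G(x₀)‖/(√2/2 − δ₁)`, `G` differentiable with derivative `G'` on `B̄(x₀, ρ)`,
`‖G'(x₀)‖ ≤ δ₁`, `‖G'(x) − G'(x₀)‖ ≤ M‖x − x₀‖` on `B̄(x₀, ρ)` ⟹ a radius `r ≤ 2‖G(x₀)‖/(√2/2 − δ₁)` with EXACTLY
ONE zero of `U + G` in `B̄(x₀, r)`, non-degenerate. This is the theorem instrument `skeleton_persist.py` v1.2 checks on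
data: budget `M_max = c²/(4|G(p)|) − 1`, `c = √2/2 − ‖∇G(p)‖`. -/
theorem exists_unique_zero_near_of_abc_eq_zero_local_one {x₀ : EuclideanSpace ℝ (Fin 3)}
    (h0 : ABC.abc 1 1 1 x₀ = 0)
    {G : EuclideanSpace ℝ (Fin 3) → EuclideanSpace ℝ (Fin 3)}
    {G' : EuclideanSpace ℝ (Fin 3) → EuclideanSpace ℝ (Fin 3) →L[ℝ] EuclideanSpace ℝ (Fin 3)}
    {M δ₁ ρ : ℝ} (hM : 0 ≤ M) (hδ : δ₁ < Real.sqrt 2 / 2)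
    (hρ : 2 * ‖G x₀‖ / (Real.sqrt 2 / 2 - δ₁) ≤ ρ)
    (hG : ∀ x ∈ closedBall x₀ ρ, HasFDerivAt G (G' x) x)
    (hlipG : ∀ x ∈ closedBall x₀ ρ, ‖G' x - G' x₀‖ ≤ M * ‖x - x₀‖)
    (hG' : ‖G' x₀‖ ≤ δ₁) (hsmall : 4 * (1 + M) * ‖G x₀‖ ≤ (Real.sqrt 2 / 2 - δ₁) ^ 2) :
    ∃ r : ℝ, 0 ≤ r ∧ r ≤ 2 * ‖G x₀‖ / (Real.sqrt 2 / 2 - δ₁) ∧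
      ∃ z ∈ closedBall x₀ r, ABC.abc 1 1 1 z + G z = 0 ∧ (fderiv ℝ (ABC.abc 1 1 1) z + G' z).IsInvertible ∧
        ∀ y ∈ closedBall x₀ r, ABC.abc 1 1 1 y + G y = 0 → y = z := by
  set c : ℝ := Real.sqrt 2 / 2 - δ₁ with hc_def
  have hc : 0 < c := by rw [hc_def]; linarith
  obtain ⟨e, he, hβ⟩ := exists_equiv_fderiv_add h0 (G' x₀) hG' hδ
  set f : EuclideanSpace ℝ (Fin 3) → EuclideanSpace ℝ (Fin 3) := fun x => ABC.abc 1 1 1 x + G x with hf_def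
  set f' : EuclideanSpace ℝ (Fin 3) → EuclideanSpace ℝ (Fin 3) →L[ℝ] EuclideanSpace ℝ (Fin 3) :=
    fun x => fderiv ℝ (ABC.abc 1 1 1) x + G' x with hf'_def
  have ha : f' x₀ = (e : EuclideanSpace ℝ (Fin 3) →L[ℝ] EuclideanSpace ℝ (Fin 3)) := by rw [he]
  have hfa : f x₀ = G x₀ := by simp [hf_def, h0]
  set η : ℝ := ‖e.symm (f x₀)‖ with hη_def
  have hη : η ≤ ‖G x₀‖ / c := by
    rw [hη_def, hfa]
    calc ‖e.symm (G x₀)‖ = ‖(e.symm : EuclideanSpace ℝ (Fin 3) →L[ℝ] EuclideanSpace ℝ (Fin 3)) (G x₀)‖ := rfl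
      _ ≤ ‖(e.symm : EuclideanSpace ℝ (Fin 3) →L[ℝ] EuclideanSpace ℝ (Fin 3))‖ * ‖G x₀‖ :=
          ContinuousLinearMap.le_opNorm _ _
      _ ≤ 1 / c * ‖G x₀‖ := mul_le_mul_of_nonneg_right hβ (norm_nonneg _)
      _ = ‖G x₀‖ / c := by ring
  have hη0 : 0 ≤ η := norm_nonneg _
  have h2η : 2 * η ≤ 2 * ‖G x₀‖ / c := by
    rw [mul_div_assoc]; exact mul_le_mul_of_nonneg_left hη (by norm_num)
  have hsub : closedBall x₀ (2 * η) ⊆ closedBall x₀ ρ := closedBall_subset_closedBall (h2η.trans hρ)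
  have hf : ∀ x ∈ closedBall x₀ (2 * η), HasFDerivAt f (f' x) x := fun x hx =>
    ((ABC.differentiable_abc 1 1 1 x).hasFDerivAt).add (hG x (hsub hx))
  have hlip : ∀ x ∈ closedBall x₀ (2 * η), ‖f' x - f' x₀‖ ≤ (1 + M) * ‖x - x₀‖ := fun x hx =>
    norm_fderiv_add_sub_le_of_radial_one (hlipG x (hsub hx))
  have hβ0 : 0 ≤ ‖(e.symm : EuclideanSpace ℝ (Fin 3) →L[ℝ] EuclideanSpace ℝ (Fin 3))‖ := norm_nonneg _
  have hcond : 4 * (1 + M) * ‖(e.symm : EuclideanSpace ℝ (Fin 3) →L[ℝ] EuclideanSpace ℝ (Fin 3))‖ * η ≤ 1 := by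
    have h1 : 4 * (1 + M) * ‖(e.symm : EuclideanSpace ℝ (Fin 3) →L[ℝ] EuclideanSpace ℝ (Fin 3))‖ * η ≤
        4 * (1 + M) * (1 / c) * (‖G x₀‖ / c) := by
      have h2M : 0 ≤ 4 * (1 + M) := by positivity
      calc 4 * (1 + M) * ‖(e.symm : EuclideanSpace ℝ (Fin 3) →L[ℝ] EuclideanSpace ℝ (Fin 3))‖ * η
          ≤ 4 * (1 + M) * (1 / c) * η := by gcongr
        _ ≤ 4 * (1 + M) * (1 / c) * (‖G x₀‖ / c) := by gcongr
    have h2 : 4 * (1 + M) * (1 / c) * (‖G x₀‖ / c) = (4 * (1 + M) * ‖G x₀‖) / c ^ 2 := by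
      field_simp
    have h3 : (4 * (1 + M) * ‖G x₀‖) / c ^ 2 ≤ 1 := by
      rw [div_le_one (by positivity)]; exact hsmall
    exact h1.trans (h2.le.trans h3)
  obtain ⟨z, hz, hfz, hinv, huniq, -⟩ :=
    Literature.Analysis.Calculus.exists_zero_near_of_simplifiedNewton (f := f) (f' := f') (a := x₀) (A := e)
      (M := 1 + M) (by positivity) hf ha hlip hcond
  exact ⟨2 * η, by positivity, h2η, z, hz, hfz, hinv, huniq⟩

/-- **PERSISTENCE FROM A HESSIAN BOUND, SHARP HOST CONSTANT**: `‖DG'‖ ≤ M` on `B̄(x₀, ρ)` and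
`4(1 + M)‖G(x₀)‖ ≤ (√2/2 − δ₁)²` (other hypotheses as in `exists_unique_zero_near_of_abc_eq_zero_of_hessian`) ⟹
exactly one zero of `U + G` within `2‖G(x₀)‖/(√2/2 − δ₁)` of `x₀`, non-degenerate. -/
theorem exists_unique_zero_near_of_abc_eq_zero_of_hessian_one {x₀ : EuclideanSpace ℝ (Fin 3)}
    (h0 : ABC.abc 1 1 1 x₀ = 0)
    {G : EuclideanSpace ℝ (Fin 3) → EuclideanSpace ℝ (Fin 3)}
    {G' : EuclideanSpace ℝ (Fin 3) → EuclideanSpace ℝ (Fin 3) →L[ℝ] EuclideanSpace ℝ (Fin 3)}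
    {G'' : EuclideanSpace ℝ (Fin 3) →
      EuclideanSpace ℝ (Fin 3) →L[ℝ] (EuclideanSpace ℝ (Fin 3) →L[ℝ] EuclideanSpace ℝ (Fin 3))}
    {M δ₁ ρ : ℝ} (hM : 0 ≤ M) (hδ : δ₁ < Real.sqrt 2 / 2)
    (hρ : 2 * ‖G x₀‖ / (Real.sqrt 2 / 2 - δ₁) ≤ ρ)
    (hG : ∀ x ∈ closedBall x₀ ρ, HasFDerivAt G (G' x) x)
    (hG'' : ∀ x ∈ closedBall x₀ ρ, HasFDerivAt G' (G'' x) x) (hbound : ∀ x ∈ closedBall x₀ ρ, ‖G'' x‖ ≤ M)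
    (hG' : ‖G' x₀‖ ≤ δ₁) (hsmall : 4 * (1 + M) * ‖G x₀‖ ≤ (Real.sqrt 2 / 2 - δ₁) ^ 2) :
    ∃ r : ℝ, 0 ≤ r ∧ r ≤ 2 * ‖G x₀‖ / (Real.sqrt 2 / 2 - δ₁) ∧
      ∃ z ∈ closedBall x₀ r, ABC.abc 1 1 1 z + G z = 0 ∧ (fderiv ℝ (ABC.abc 1 1 1) z + G' z).IsInvertible ∧
        ∀ y ∈ closedBall x₀ r, ABC.abc 1 1 1 y + G y = 0 → y = z :=
  exists_unique_zero_near_of_abc_eq_zero_local_one h0 hM hδ hρ hG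
    (radial_lipschitz_of_norm_fderiv_le hG'' hbound) hG' hsmall

end Summit.NavierStokesRegularity.FluidComputer.ABCSkeletonPersistenceLocal
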